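import Literature.NumberTheory.EllipticCurves.ZpExtensionEisensteinSelmerLimitGlue
import HarnessLib

/-!
# `F_𝔮` along the typed Eisenstein tower: the `DVRSetting.SatisfiesH` clauses `cond_smul` and `cond_red` in
# lit's spelling (theorems only; no definition, no named fact, no instance)

Topic `NumberTheory/EllipticCurves` (D1 road of cell `pub/bsd-print-x9`; companion of
`ZpExtensionEisensteinSelmerStructure[Proofs]`, `ZpExtensionEisensteinAdicTower` (x9-p1-w3) and
`GaloisCohomology/Howard2004/DVRKolyvaginBound` ((W9)-B)). The hypothesis structure `Howard2004.DVRSetting.SatisfiesH`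
of the cite-only fact `thm161_dvrKolyvaginBound` asks of the level-wise Selmer structures `(S.t k).cond`:
`cond_smul` (each local condition is an `R`-submodule for the scalar action of the DVR `R = S_𝔪`) and `cond_red`
(the reduction `T^{(k+1)} → T^{(k)}` maps the level-`k+1` condition ONTO the level-`k` condition at every place).
For Howard's `F_𝔮 = κ.eisensteinSelmerStructure ρ t hm S Φ` on the tower `κ.eisensteinAdicTower ρ t hm ht`
(levels `T_𝔮/p^k = M_k ⊗ A_{m,k}(ψ)`, `R = S_m = Λ/(q_m)` acting through `A_{m,k}`):

* §1 generic: `galoisCohomology.scalarMapH1_eq_of_forall_smul_eq` — `H¹(r•)` depends only on the map `m ↦ r • m`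
  (two coefficient rings acting compatibly); `Tower.map_levelCondition_succ_eq` — the reduction maps the
  level-`k+1` condition ONTO the level-`k` condition (both are images of the same saturated families);
  `ZpExtension.cohomologyMap_toLocal_eq_eisensteinLocalReduce` — lit's `ContinuousRep.cohomologyMap` spelling of the
  local reduction of the typed tower IS D1's `eisensteinLocalReduce`.
* §2 **`ZpExtension.map_scalarMapH1_eisensteinSelmerStructure_le`** = `cond_smul` for `F_𝔮` verbatim (scalars
  `r ∈ S_m`, through `isScalarStable_eisensteinSelmerStructure` at the image of `r` in `A_{m,k}`);
  **`ZpExtension.map_red_eisensteinSelmerStructure_le`** = the inclusion `≤` of `cond_red` at EVERY place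
  (`eisensteinLocalReduce_mem_eisensteinSelmerStructure`), and
  **`ZpExtension.map_red_eisensteinSelmerStructure_eq_of_mem` / `…_eq_of_mem_finset`** = the EQUALITY of `cond_red`
  at the places `v ∣ p` and `v ∈ S` (saturated towers). At the remaining finite places (plain unramified condition)
  equality is the surjectivity of `H¹_ur(K_v, W_{k+1}) → H¹_ur(K_v, W_k)` for unramified levels, and at the infinite
  places (`⊤`) the surjectivity of the reduction on `H¹(K_w, ·)` — NOT proved here (recorded as the residual of
  `cond_red` for the D1 tower).

Theorems only; no `sorry`. BSD is not proved by any of this.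

References: [Howard2004HeegnerKolyvagin] Def. 1.1.1, Def. 1.1.3, §1.6 (arXiv p. 5; p. 12, L29–55), Def. 3.1.2;
[SerreGaloisCohomology1997] I §2.2, §2.4, §5.1.
-/

noncomputable section

open scoped TensorProduct ContRepresentation
open Field IsLocalRing IsDedekindDomain
open scoped NumberField

universe u

/-! ## §1 Generic pieces -/

namespace Literature.NumberTheory.GaloisRepresentations.galoisCohomology

variable {K : Type u} [Field K] {M : Type u} [AddCommGroup M] [TopologicalSpace M] [DiscreteTopology M]
  {ρ : DiscreteGaloisModule K M}

/-- **`H¹(r•)` depends only on the endomorphism `m ↦ r • m`**: for two coefficient rings `R`, `R'` acting on `M`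
with `ρ` linear for both, and `r ∈ R`, `r' ∈ R'` acting by the same map, `H¹(r•) = H¹(r'•)` (both are
`[φ] ↦ [σ ↦ r • φ σ]`). Used to pass between `S_m` acting through `A_{m,k}` and `A_{m,k}` itself.
[cite: SerreGaloisCohomology1997, Ch. I §2.2 (functoriality in the coefficients) and §5.1] -/
theorem scalarMapH1_eq_of_forall_smul_eq {R R' : Type*} [Ring R] [Ring R'] [Module R M] [Module R' M]
    (hρ : ρ.IsScalarLinear R) (hρ' : ρ.IsScalarLinear R') {r : R} {r' : R'} (h : ∀ m : M, r • m = r' • m) :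
    scalarMapH1 ρ hρ r = scalarMapH1 ρ hρ' r' := by
  refine AddMonoidHom.ext fun x ↦ ?_
  obtain ⟨φ, rfl⟩ := oneCocycleClass_surjective ρ.toTopRep x
  rw [scalarMapH1_oneCocycleClass, scalarMapH1_oneCocycleClass]
  exact congrArg _ (Subtype.ext (ContinuousMap.ext fun σ ↦ by
    rw [scalarCocycle_apply, scalarCocycle_apply, h]))

end Literature.NumberTheory.GaloisRepresentations.galoisCohomology

namespace Literature.NumberTheory.EllipticCurves

open Literature.NumberTheory.GaloisRepresentations
open Literature.NumberTheory.GaloisCohomology.Howard2004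

namespace Tower

variable {H : ℕ → Type u} [∀ j, AddCommGroup (H j)] (red : ∀ j, H (j + 1) →+ H j)

/-- **The reduction maps the level-`k+1` condition ONTO the level-`k` condition**: both are the images of the same
group of saturated families, under `eval_{k+1}` and `eval_k = red_k ∘ eval_{k+1}`. (The `≤` half is
`red_mem_levelCondition`.) [cite: Howard2004HeegnerKolyvagin, Def. 1.1.3 (arXiv: F on T/𝔪^k propagated from T) and §1.6] -/
theorem map_levelCondition_succ_eq (p : ℕ) (C : ∀ j, AddSubgroup (H j)) (k : ℕ) :
    (levelCondition red p C (k + 1)).map (red k) = levelCondition red p C k := by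
  refine le_antisymm ?_ fun y hy ↦ ?_
  · rintro _ ⟨y, hy, rfl⟩
    exact red_mem_levelCondition red p C hy
  · rw [mem_levelCondition_iff] at hy
    obtain ⟨x, hx, rfl⟩ := hy
    refine ⟨x (k + 1), apply_mem_levelCondition red p C hx (k + 1), ?_⟩
    exact ((mem_saturatedFamilies_iff red p C x).1 hx).1 k

end Tower

namespace ZpExtension

variable {K : Type} [Field K] [NumberField K] {p : ℕ} [hp : Fact p.Prime] (κ : ZpExtension K p)
  {M : ℕ → Type} [∀ k, AddCommGroup (M k)] [∀ k, TopologicalSpace (M k)] [∀ k, DiscreteTopology (M k)]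
  (ρ : ∀ k, DiscreteGaloisModule K (M k))
  (t : ∀ k, (ρ (k + 1)).toContRepresentation →ⁱL (ρ k).toContRepresentation)
  {m : ℕ} (hm : 1 ≤ m) (ht : ∀ k, Function.Surjective (t k))
  (S : Finset (HeightOneSpectrum (𝓞 K)))
  (Φ : ∀ v : HeightOneSpectrum (𝓞 K), ((p : ℕ) : 𝓞 K) ∈ v.asIdeal → OrdinaryFiltration ρ t v)

/-- **lit's local reduction of the typed tower IS D1's `eisensteinLocalReduce`**: `ContinuousRep.cohomologyMap` of
`(eisensteinAdicTower …).red k` between the local modules at `v` equals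
`galoisCohomology.map (localMap (eisensteinTwistReduce …) v) 1` (same function on cocycles).
[cite: SerreGaloisCohomology1997, Ch. I §2.2 and §2.4] [cite: Howard2004HeegnerKolyvagin, §1.6 (arXiv p. 12, L29–55)] -/
theorem cohomologyMap_toLocal_eq_eisensteinLocalReduce (k : ℕ) (v : NumberField.Place K) :
    letI := IwasawaAlgebra.isLocalRing_quotient_X_pow_add_C p hm
    ContinuousRep.cohomologyMap (((κ.eisensteinAdicTower ρ t hm ht).ρ (k + 1)).toLocal v)
        (((κ.eisensteinAdicTower ρ t hm ht).ρ k).toLocal v)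
        ((κ.eisensteinAdicTower ρ t hm ht).red k).toAddMonoidHom continuous_of_discreteTopology
        (fun _ x ↦ (κ.eisensteinAdicTower ρ t hm ht).red_equivariant k _ x) 1 =
      κ.eisensteinLocalReduce ρ t hm v k := by
  letI := IwasawaAlgebra.isLocalRing_quotient_X_pow_add_C p hm
  refine AddMonoidHom.ext fun x ↦ ?_
  obtain ⟨φ, rfl⟩ := oneCocycleClass_surjective
    (DiscreteGaloisModule.toTopRep (((κ.eisensteinAdicTower ρ t hm ht).ρ (k + 1)).toLocal v)) x
  change ContinuousCohomology.map _ _ 1 _ = ContinuousCohomology.map _ _ 1 _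
  erw [map_oneCocycleClass]

/-- **`cond_smul` for `F_𝔮`**: at every place, `F_𝔮` at level `k` is stable under the local scalar action `H¹(r•)`
of `r ∈ S_m = Λ/(q_m)` on the typed level `T_𝔮/p^k` (`S_m` acts through its image in `A_{m,k}`, where
`isScalarStable_eisensteinSelmerStructure` applies). [cite: Howard2004HeegnerKolyvagin, Def. 1.1.1 (arXiv Def. 2.1.1: local conditions are R-submodules)] -/
theorem map_scalarMapH1_eisensteinSelmerStructure_le (k : ℕ) (v : NumberField.Place K)
    (r : IwasawaAlgebra p ⧸
      Ideal.span {(PowerSeries.X ^ m + PowerSeries.C (p : ℤ_[p]) : IwasawaAlgebra p)}) :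
    letI := IwasawaAlgebra.isLocalRing_quotient_X_pow_add_C p hm
    (κ.eisensteinSelmerStructure ρ t hm S Φ k v).map
        (galoisCohomology.scalarMapH1 (((κ.eisensteinAdicTower ρ t hm ht).ρ k).toLocal v)
          (((κ.eisensteinAdicTower ρ t hm ht).hlin k).restrictField _) r) ≤
      κ.eisensteinSelmerStructure ρ t hm S Φ k v := by
  letI := IwasawaAlgebra.isLocalRing_quotient_X_pow_add_C p hm
  obtain ⟨f, rfl⟩ := Ideal.Quotient.mk_surjective r
  rintro _ ⟨x, hx, rfl⟩
  have heq : galoisCohomology.scalarMapH1 (((κ.eisensteinAdicTower ρ t hm ht).ρ k).toLocal v)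
        (((κ.eisensteinAdicTower ρ t hm ht).hlin k).restrictField _) (Ideal.Quotient.mk _ f) =
      galoisCohomology.scalarMapH1 ((κ.eisensteinTwist (ρ k) hm k).toLocal v)
        ((κ.isScalarLinear_eisensteinTwist (ρ k) hm k).restrictField _)
        (Ideal.Quotient.mk _ f : IwasawaAlgebra.EisensteinCoeff p m k) :=
    galoisCohomology.scalarMapH1_eq_of_forall_smul_eq _ _ fun y ↦ EisensteinLevel.quotient_mk_smul_def k f y
  rw [heq]
  exact (DiscreteGaloisModule.SelmerStructure.isScalarStable_iff _ _).1
    (κ.isScalarStable_eisensteinSelmerStructure ρ t hm S Φ k) v _ hx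

/-- **`cond_red` for `F_𝔮`, the inclusion**: at every place the reduction of the typed tower maps `F_𝔮` at level
`k+1` into `F_𝔮` at level `k` (`eisensteinLocalReduce_mem_eisensteinSelmerStructure` in lit's spelling).
[cite: Howard2004HeegnerKolyvagin, Def. 1.1.3 and §1.6 (arXiv p. 12)] -/
theorem map_red_eisensteinSelmerStructure_le (k : ℕ) (v : NumberField.Place K) :
    letI := IwasawaAlgebra.isLocalRing_quotient_X_pow_add_C p hm
    (κ.eisensteinSelmerStructure ρ t hm S Φ (k + 1) v).map
        (ContinuousRep.cohomologyMap (((κ.eisensteinAdicTower ρ t hm ht).ρ (k + 1)).toLocal v)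
          (((κ.eisensteinAdicTower ρ t hm ht).ρ k).toLocal v)
          ((κ.eisensteinAdicTower ρ t hm ht).red k).toAddMonoidHom continuous_of_discreteTopology
          (fun _ x ↦ (κ.eisensteinAdicTower ρ t hm ht).red_equivariant k _ x) 1) ≤
      κ.eisensteinSelmerStructure ρ t hm S Φ k v := by
  letI := IwasawaAlgebra.isLocalRing_quotient_X_pow_add_C p hm
  rw [κ.cohomologyMap_toLocal_eq_eisensteinLocalReduce ρ t hm ht k v]
  rintro _ ⟨y, hy, rfl⟩
  exact κ.eisensteinLocalReduce_mem_eisensteinSelmerStructure ρ t hm S Φ k v hy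

/-- **`cond_red` for `F_𝔮`, EQUALITY at `v ∣ p`**: the reduction maps the level-`k+1` condition ONTO the level-`k`
condition (images of the same saturated ordinary families). [cite: Howard2004HeegnerKolyvagin, Def. 1.1.3, §1.6 and Def. 3.1.2] -/
theorem map_red_eisensteinSelmerStructure_eq_of_mem (k : ℕ) {v : HeightOneSpectrum (𝓞 K)}
    (hv : ((p : ℕ) : 𝓞 K) ∈ v.asIdeal) :
    letI := IwasawaAlgebra.isLocalRing_quotient_X_pow_add_C p hm
    (κ.eisensteinSelmerStructure ρ t hm S Φ (k + 1) (Sum.inr v)).map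
        (ContinuousRep.cohomologyMap (((κ.eisensteinAdicTower ρ t hm ht).ρ (k + 1)).toLocal (Sum.inr v))
          (((κ.eisensteinAdicTower ρ t hm ht).ρ k).toLocal (Sum.inr v))
          ((κ.eisensteinAdicTower ρ t hm ht).red k).toAddMonoidHom continuous_of_discreteTopology
          (fun _ x ↦ (κ.eisensteinAdicTower ρ t hm ht).red_equivariant k _ x) 1) =
      κ.eisensteinSelmerStructure ρ t hm S Φ k (Sum.inr v) := by
  letI := IwasawaAlgebra.isLocalRing_quotient_X_pow_add_C p hm
  rw [κ.cohomologyMap_toLocal_eq_eisensteinLocalReduce ρ t hm ht k (Sum.inr v),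
    κ.eisensteinSelmerStructure_inr_of_mem ρ t hm S Φ (k + 1) hv, κ.eisensteinSelmerStructure_inr_of_mem ρ t hm S Φ k hv]
  exact Tower.map_levelCondition_succ_eq
    (H := fun j ↦ galoisCohomology ((κ.eisensteinTwist (ρ j) hm j).toLocal (Sum.inr v)) 1)
    (κ.eisensteinLocalReduce ρ t hm (Sum.inr v)) p _ k

/-- **`cond_red` for `F_𝔮`, EQUALITY at `v ∈ S`, `v ∤ p`** (saturated unramified tower).
[cite: Howard2004HeegnerKolyvagin, Def. 1.1.3, §1.6 and Def. 3.1.2] -/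
theorem map_red_eisensteinSelmerStructure_eq_of_mem_finset (k : ℕ) {v : HeightOneSpectrum (𝓞 K)}
    (hv : ((p : ℕ) : 𝓞 K) ∉ v.asIdeal) (hvS : v ∈ S) :
    letI := IwasawaAlgebra.isLocalRing_quotient_X_pow_add_C p hm
    (κ.eisensteinSelmerStructure ρ t hm S Φ (k + 1) (Sum.inr v)).map
        (ContinuousRep.cohomologyMap (((κ.eisensteinAdicTower ρ t hm ht).ρ (k + 1)).toLocal (Sum.inr v))
          (((κ.eisensteinAdicTower ρ t hm ht).ρ k).toLocal (Sum.inr v))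
          ((κ.eisensteinAdicTower ρ t hm ht).red k).toAddMonoidHom continuous_of_discreteTopology
          (fun _ x ↦ (κ.eisensteinAdicTower ρ t hm ht).red_equivariant k _ x) 1) =
      κ.eisensteinSelmerStructure ρ t hm S Φ k (Sum.inr v) := by
  letI := IwasawaAlgebra.isLocalRing_quotient_X_pow_add_C p hm
  rw [κ.cohomologyMap_toLocal_eq_eisensteinLocalReduce ρ t hm ht k (Sum.inr v),
    κ.eisensteinSelmerStructure_inr_of_mem_of_not_mem ρ t hm S Φ (k + 1) hv hvS,
    κ.eisensteinSelmerStructure_inr_of_mem_of_not_mem ρ t hm S Φ k hv hvS]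
  exact Tower.map_levelCondition_succ_eq
    (H := fun j ↦ galoisCohomology ((κ.eisensteinTwist (ρ j) hm j).toLocal (Sum.inr v)) 1)
    (κ.eisensteinLocalReduce ρ t hm (Sum.inr v)) p _ k

end ZpExtension

end Literature.NumberTheory.EllipticCurves

end
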